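import Summits.BirchSwinnertonDyer.BirchSwinnertonDyer.Theorems.KolyvaginDepthDoorDepthTableSteinWuthrich
import Summits.BirchSwinnertonDyer.BirchSwinnertonDyer.Theorems.KolyvaginDepthDoorDepthTableRowsTwoSha1
import Summits.BirchSwinnertonDyer.BirchSwinnertonDyer.Theorems.KolyvaginDepthDoorDepthTableRowsTwoSha2
import Summits.BirchSwinnertonDyer.BirchSwinnertonDyer.Theorems.KolyvaginDepthDoorDepthTableRowsRankDischarged
import HarnessLib

/-!
# Route `KolyvaginDepthDoor`, crux `KolyvaginDepthSupplyKN` (stmt-BirchSwinnertonDyer-22820) —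
# DEPTH TABLE v13 «ONE BIT ⟺ ONE rank-one twist» (part 4: `571b1`, `643a1` at `(5, −8)`)

Helper file of the lead prover of line `levelone` (kdd-p1 g17; `--supports stmt-BirchSwinnertonDyer-22820
--as helper`); it closes nothing and BSD is NOT proved by it.

Sequel of `KolyvaginDepthDoorDepthTableSteinWuthrich` (pattern at `389a1`; the named fact = Stein–Wuthrich 2013
Thm. 1.1, `Literature.NumberTheory.EllipticCurves.SteinWuthrich2013_sha_inf_torsionBy_eq_bot_of_two_le_rank`:
`Ш(E/ℚ)[p] = 0` for every non-CM `E` of rank `≥ 2`, `N ≤ 30 000`, at every good ordinary `5 ≤ p < 1000` with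
`ρ̄_{E,p}` onto). For each curve `E` below at its depth-table prime `p` and Heegner discriminant(s) `d_K`:

* `C<label>.sha_inf_torsionBy_<p>_eq_bot` — `Ш(E/ℚ)[p] = 0` BY NAME (SW Thm. 1.1 at the lineage's kernel
  certificates: non-CM, `2 ≤ rank`, `N ≤ 30000`, `p` good ordinary, `ρ̄_{E,p}` onto);
* `C<label>.exactRow[Zhang]_<p>_neg<D>_oneTwist` — the v13 row: bit `↔` «`rank_ℤ E^{(d_K)}(ℚ) = 1` ∧
  `Ш(E^{(d_K)}/ℚ)[p] = 0`» (from the v12 «two Ш» row, the `E`-side conjunct discharged in print);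
* `C<label>.exactRow[Zhang]_<p>_neg<D>_twistSelmer` — bit `↔` `#Sel_p(E^{(d_K)}/ℚ) ≤ p` (from the v11 row);
* `C<label>.cruxBody_of_twistSelmer` — the CLAUSE of the crux `KolyvaginDepthSupplyKN` at `E`, verbatim, from
  ONE `p`-Selmer bound on ONE rank-one Heegner twist (witnesses `p`, `K`, `n₁ = ℓ`, first sign `ν + 1 = 2 ≤ rank`).

So at these curves the instrument's bit is exactly the `p`-part of BSD of ONE RANK-ONE curve, and the crux
instance is one rank-one datum away (not a Kolyvagin-class computation). CONDITIONAL on the rows' named print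
facts ((γ) = Gross 1991 Prop. 3.7 (2) and W. Zhang 2014 Lemma 8.4 (1) / Thm. 9.1 on the ♠ rows; (γ),
Castella–Sano 2026 Thm. 3, Zanarella 2019 Prop. 2.18, Howard–Zanarella, modularity and Mazur's Manin bound on
the split rows) and on Stein–Wuthrich 2013 Thm. 1.1, all BY NAME; per curve; nothing class-wide (the open stub
(S♭) is untouched); BSD is NOT proved by any of this.

References: [SteinWuthrich2013] Thm. 1.1 (p. 1758), §12.4; [WZhang2014] Lemma 8.4 (1), Thm. 9.1;
[CastellaSano2026] Thm. 3; [GrossLMS1991] Prop. 3.7 (2); [SilvermanAEC2009] X.4.2; [CremonaAlgorithms1997] Table 1.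
-/

set_option linter.dupNamespace false

noncomputable section

open scoped Classical NumberField

namespace Summit.BirchSwinnertonDyer.BirchSwinnertonDyer.Theorems.KolyvaginDepthDoor

open Literature.NumberTheory.EllipticCurves Literature.NumberTheory.EllipticCurves.ModularForms
  WeierstrassCurve NumberField IsDedekindDomain
open Summit.BirchSwinnertonDyer.BirchSwinnertonDyer.Theorems
open Summit.BirchSwinnertonDyer.BirchSwinnertonDyer.Rank2Observatory

/-! ## `571b1` (`N = 571`) at `p = 5` -/

namespace C571b1

/-- **`Ш(571b1/ℚ)[5] = 0` BY NAME** (Stein–Wuthrich 2013 Thm. 1.1 at the kernel-certified hypotheses of the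
lineage: non-CM `not_hasCM`, `2 ≤ rank` `KernelCerts001.C571b1.two_le_rank`, `N ≤ `571 ≤ 30000` (`conductorNorm_eq`)` , `5` good
ordinary `goodOrdinary_5`, `ρ̄_{E,5}` onto `hasSurjectiveModNGaloisRep_pow_5 1`). CONDITIONAL on that named fact; per curve;
BSD is not proved by it. [cite: SteinWuthrich2013, Thm. 1.1 (p. 1758)] [cite: CremonaAlgorithms1997, Table 1 (571b1)] -/
theorem sha_inf_torsionBy_five_eq_bot (hSW : SteinWuthrich2013_sha_inf_torsionBy_eq_bot_of_two_le_rank) :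
    haveI := isElliptic_c571b1;
    haveI := isGloballyMinimal_c571b1;
    haveI := Fact.mk (by norm_num : Nat.Prime 5);
    (((⟨0, 1, 1, -4, 2⟩ : WeierstrassCurve ℤ).map (Int.castRingHom ℚ)).sha ⊓ AddSubgroup.torsionBy ((⟨0, 1, 1, -4, 2⟩ : WeierstrassCurve ℤ).map (Int.castRingHom ℚ)).galH1 ((5 : ℕ) : ℤ) : AddSubgroup _) = ⊥ := by
  haveI := isElliptic_c571b1
  haveI := isGloballyMinimal_c571b1
  haveI := Fact.mk (by norm_num : Nat.Prime 5)
  have hsur : ((⟨0, 1, 1, -4, 2⟩ : WeierstrassCurve ℤ).map (Int.castRingHom ℚ)).HasSurjectiveModNGaloisRep (5 ^ 1 : ℕ) := hasSurjectiveModNGaloisRep_pow_5 1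
  rw [pow_one] at hsur
  exact hSW _ not_hasCM KernelCerts001.C571b1.two_le_rank (by rw [conductorNorm_eq]; norm_num) 5 (by norm_num) (by norm_num)
    goodOrdinary_5.1 goodOrdinary_5.2 hsur

/-- **DEPTH-TABLE ROW `571b1`, `(p, d_K) = (5, -8)`, v13 — «ONE BIT ⟺ ONE TWIST».** For `E = 571b1` and ANY
imaginary quadratic `K` with `d_K = -8`: «some frame, some Kolyvagin prime `ℓ`, some datum of conductor `ℓ` with
`c_1(ℓ) ≠ 0`» `↔` «`rank_ℤ E^{(-8)}(ℚ) = 1` ∧ `Ш(E^{(-8)}/ℚ)[5] = 0`» — the `5`-part of BSD for the rank-one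
Heegner twist ALONE. From the v12 row `exactRowZhang_5_neg8_twoSha` with its conjunct `Ш(E)[5] = 0` discharged by
Stein–Wuthrich Thm. 1.1 (`sha_inf_torsionBy_five_eq_bot`). CONDITIONAL on (γ), W. Zhang's Lemma 8.4 (1) / Thm. 9.1 and SW Thm. 1.1 by
name; per curve; BSD is not proved by it. [cite: SteinWuthrich2013, Thm. 1.1 (p. 1758)] [cite: WZhang2014, Lemma 8.4 (1) (p. 236), Thm. 9.1 (p. 240)] [cite: GrossLMS1991, Prop. 3.7 (2)]
[cite: SilvermanAEC2009, Thm. X.4.2] -/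
theorem exactRowZhang_5_neg8_oneTwist
    (hSW : SteinWuthrich2013_sha_inf_torsionBy_eq_bot_of_two_le_rank)
    (h372 : GrossLMS1991.prop37_2_frobeniusCongruence)
    (h84 : Literature.NumberTheory.EllipticCurves.WZhang2014_lemma84_exists_minimal_kolyvaginClass_one_selmerCard)
    (K : Type) [Field K] [NumberField K] (hK : IsImaginaryQuadratic K)
    (hD : NumberField.discr K = -8) :
    haveI := isElliptic_c571b1;
    haveI := isGloballyMinimal_c571b1;
    haveI : NeZero (((⟨0, 1, 1, -4, 2⟩ : WeierstrassCurve ℤ).map (Int.castRingHom ℚ)).conductorNorm ℤ) := neZero_conductorNorm_of_isElliptic _;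
    haveI := Fact.mk (by norm_num : Nat.Prime 5);
    (∃ (Dt : ModularParametrizationData ((⟨0, 1, 1, -4, 2⟩ : WeierstrassCurve ℤ).map (Int.castRingHom ℚ)) (((⟨0, 1, 1, -4, 2⟩ : WeierstrassCurve ℤ).map (Int.castRingHom ℚ)).conductorNorm ℤ)) (β : ℤ)
      (ι : K →+* ℂ) (ℓ : ℕ) (d : KolyvaginHeegnerData Dt β ι ℓ),
      ℓ.Prime ∧ Zhang2014.IsKolyvaginPrime (((⟨0, 1, 1, -4, 2⟩ : WeierstrassCurve ℤ).map (Int.castRingHom ℚ)).conductorNorm ℤ) ((⟨0, 1, 1, -4, 2⟩ : WeierstrassCurve ℤ).map (Int.castRingHom ℚ)) K 5 ℓ ∧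
        d.kolyvaginClass (p := 5) (by norm_num) 1 ≠ 0) ↔
    ((((⟨0, 1, 1, -4, 2⟩ : WeierstrassCurve ℤ).map (Int.castRingHom ℚ)).quadraticTwist (NumberField.discr K : ℚ)).mordellWeilRank = 1 ∧
      ((((⟨0, 1, 1, -4, 2⟩ : WeierstrassCurve ℤ).map (Int.castRingHom ℚ)).quadraticTwist (NumberField.discr K : ℚ)).sha ⊓
          AddSubgroup.torsionBy (((⟨0, 1, 1, -4, 2⟩ : WeierstrassCurve ℤ).map (Int.castRingHom ℚ)).quadraticTwist (NumberField.discr K : ℚ)).galH1 ((5 : ℕ) : ℤ) :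
          AddSubgroup (((⟨0, 1, 1, -4, 2⟩ : WeierstrassCurve ℤ).map (Int.castRingHom ℚ)).quadraticTwist (NumberField.discr K : ℚ)).galH1) = ⊥) := by
  haveI := isElliptic_c571b1
  haveI := isGloballyMinimal_c571b1
  haveI : NeZero (((⟨0, 1, 1, -4, 2⟩ : WeierstrassCurve ℤ).map (Int.castRingHom ℚ)).conductorNorm ℤ) := neZero_conductorNorm_of_isElliptic _
  haveI := Fact.mk (by norm_num : Nat.Prime 5)
  exact (exactRowZhang_5_neg8_twoSha h372 h84 K hK hD).trans
    (and_iff_right (sha_inf_torsionBy_five_eq_bot hSW))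

/-- **DEPTH-TABLE ROW `571b1`, `(p, d_K) = (5, -8)`, v13 in Selmer currency — «ONE BIT ⟺ ONE TWIST-SELMER
BOUND».** For `E = 571b1` and ANY imaginary quadratic `K` with `d_K = -8`: bit `↔` `#Sel_5(E^{(-8)}/ℚ) ≤ 5`
(`dim Sel_5(E^{(-8)}) ≤ 1` over `𝔽_5`). From the v11 row `exactRowZhang_5_neg8_rankFree` with `Ш(E)[5] = 0` discharged by
SW Thm. 1.1. CONDITIONAL on (γ), W. Zhang's Lemma 8.4 (1) / Thm. 9.1 and SW Thm. 1.1 by name; per curve; BSD is not proved by it.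
[cite: SteinWuthrich2013, Thm. 1.1 (p. 1758)] [cite: WZhang2014, Lemma 8.4 (1) (p. 236), Thm. 9.1 (p. 240)] [cite: GrossLMS1991, Prop. 3.7 (2)] -/
theorem exactRowZhang_5_neg8_twistSelmer
    (hSW : SteinWuthrich2013_sha_inf_torsionBy_eq_bot_of_two_le_rank)
    (h372 : GrossLMS1991.prop37_2_frobeniusCongruence)
    (h84 : Literature.NumberTheory.EllipticCurves.WZhang2014_lemma84_exists_minimal_kolyvaginClass_one_selmerCard)
    (K : Type) [Field K] [NumberField K] (hK : IsImaginaryQuadratic K)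
    (hD : NumberField.discr K = -8) :
    haveI := isElliptic_c571b1;
    haveI := isGloballyMinimal_c571b1;
    haveI : NeZero (((⟨0, 1, 1, -4, 2⟩ : WeierstrassCurve ℤ).map (Int.castRingHom ℚ)).conductorNorm ℤ) := neZero_conductorNorm_of_isElliptic _;
    haveI := Fact.mk (by norm_num : Nat.Prime 5);
    (∃ (Dt : ModularParametrizationData ((⟨0, 1, 1, -4, 2⟩ : WeierstrassCurve ℤ).map (Int.castRingHom ℚ)) (((⟨0, 1, 1, -4, 2⟩ : WeierstrassCurve ℤ).map (Int.castRingHom ℚ)).conductorNorm ℤ)) (β : ℤ)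
      (ι : K →+* ℂ) (ℓ : ℕ) (d : KolyvaginHeegnerData Dt β ι ℓ),
      ℓ.Prime ∧ Zhang2014.IsKolyvaginPrime (((⟨0, 1, 1, -4, 2⟩ : WeierstrassCurve ℤ).map (Int.castRingHom ℚ)).conductorNorm ℤ) ((⟨0, 1, 1, -4, 2⟩ : WeierstrassCurve ℤ).map (Int.castRingHom ℚ)) K 5 ℓ ∧
        d.kolyvaginClass (p := 5) (by norm_num) 1 ≠ 0) ↔
    Nat.card ((((⟨0, 1, 1, -4, 2⟩ : WeierstrassCurve ℤ).map (Int.castRingHom ℚ)).quadraticTwist (NumberField.discr K : ℚ)).selmerGroup (5 : ℕ)) ≤ 5 := by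
  haveI := isElliptic_c571b1
  haveI := isGloballyMinimal_c571b1
  haveI : NeZero (((⟨0, 1, 1, -4, 2⟩ : WeierstrassCurve ℤ).map (Int.castRingHom ℚ)).conductorNorm ℤ) := neZero_conductorNorm_of_isElliptic _
  haveI := Fact.mk (by norm_num : Nat.Prime 5)
  exact (exactRowZhang_5_neg8_rankFree h372 h84 K hK hD).trans
    (and_iff_right (sha_inf_torsionBy_five_eq_bot hSW))

/-- **THE CRUX `KolyvaginDepthSupplyKN` AT `571b1`, MODULO ONE RANK-ONE DATUM.** Granted the named print facts
(SW Thm. 1.1, (γ), W. Zhang's Lemma 8.4 (1) / Thm. 9.1) and, for ONE imaginary quadratic `K` with `d_K = -8`, the `5`-Selmer bound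
`#Sel_5(E^{(d_K)}/ℚ) ≤ 5` of the rank-one Heegner twist (one `5`-descent-free rank-one datum), the CLAUSE of the
crux holds at `W = 571b1` VERBATIM: witnesses `p = 5` (good ordinary, `ρ_{E,5^∞}` onto `hasSurjectiveModNGaloisRep_pow_5`,
Kodaira–Néron from `Δ(E₀) = -571`), that `K` (Heegner, `heegner_neg8`), `n₁ = ℓ` the Kolyvagin prime of the row's
non-zero class (`exactRowZhang_5_neg8_twistSelmer`, ←), first sign `ν(ℓ) + 1 = 2 ≤ rank_ℤ E(ℚ)` (`KernelCerts001.C571b1.two_le_rank`).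
CONDITIONAL on the named facts and the one twist datum; per curve (the open stub (S♭) is untouched); BSD is not proved
by it. [cite: SteinWuthrich2013, Thm. 1.1 (p. 1758)] [cite: WZhang2014, Lemma 8.4 (1) (p. 236), Thm. 9.1 (p. 240)] [cite: GrossLMS1991, Prop. 3.7 (2)] [cite: CremonaAlgorithms1997, Table 1 (571b1)] -/
theorem cruxBody_of_twistSelmer
    (hSW : SteinWuthrich2013_sha_inf_torsionBy_eq_bot_of_two_le_rank)
    (h372 : GrossLMS1991.prop37_2_frobeniusCongruence)
    (h84 : Literature.NumberTheory.EllipticCurves.WZhang2014_lemma84_exists_minimal_kolyvaginClass_one_selmerCard)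
    (K : Type) [Field K] [NumberField K] (hK : IsImaginaryQuadratic K)
    (hD : NumberField.discr K = -8)
    (hT : haveI := isElliptic_c571b1; haveI := isGloballyMinimal_c571b1; 
      Nat.card ((((⟨0, 1, 1, -4, 2⟩ : WeierstrassCurve ℤ).map (Int.castRingHom ℚ)).quadraticTwist (NumberField.discr K : ℚ)).selmerGroup (5 : ℕ)) ≤ 5) :
    haveI := isElliptic_c571b1;
    haveI := isGloballyMinimal_c571b1;
    ∃ (p : ℕ) (hp : Fact p.Prime), 5 ≤ p ∧ ((⟨0, 1, 1, -4, 2⟩ : WeierstrassCurve ℤ).map (Int.castRingHom ℚ)).HasGoodReductionAtPrime p ∧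
      ¬ (p : ℤ) ∣ ((⟨0, 1, 1, -4, 2⟩ : WeierstrassCurve ℤ).map (Int.castRingHom ℚ)).frobeniusTrace p ∧ (∀ n : ℕ, ((⟨0, 1, 1, -4, 2⟩ : WeierstrassCurve ℤ).map (Int.castRingHom ℚ)).HasSurjectiveModNGaloisRep (p ^ n : ℕ)) ∧
      (∀ v : HeightOneSpectrum (𝓞 ℚ), ((⟨0, 1, 1, -4, 2⟩ : WeierstrassCurve ℤ).map (Int.castRingHom ℚ)).HasMultiplicativeReductionAt v →
        ¬ p ∣ ((⟨0, 1, 1, -4, 2⟩ : WeierstrassCurve ℤ).map (Int.castRingHom ℚ)).ordMinimalDiscriminant v) ∧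
      ∃ (K : Type) (_ : Field K) (_ : NumberField K), IsImaginaryQuadratic K ∧
        NumberField.discr K ≠ -3 ∧ NumberField.discr K ≠ -4 ∧
        ∃ (_ : NeZero (((⟨0, 1, 1, -4, 2⟩ : WeierstrassCurve ℤ).map (Int.castRingHom ℚ)).conductorNorm ℤ)), SatisfiesHeegnerHypothesis (((⟨0, 1, 1, -4, 2⟩ : WeierstrassCurve ℤ).map (Int.castRingHom ℚ)).conductorNorm ℤ) K ∧
        ∃ (Dt : ModularParametrizationData ((⟨0, 1, 1, -4, 2⟩ : WeierstrassCurve ℤ).map (Int.castRingHom ℚ)) (((⟨0, 1, 1, -4, 2⟩ : WeierstrassCurve ℤ).map (Int.castRingHom ℚ)).conductorNorm ℤ)) (β : ℤ) (ι : K →+* ℂ) (n₁ : ℕ)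
          (d : KolyvaginHeegnerData Dt β ι n₁), Squarefree n₁ ∧
          (∀ q ∈ n₁.primeFactors, Zhang2014.IsKolyvaginPrime (((⟨0, 1, 1, -4, 2⟩ : WeierstrassCurve ℤ).map (Int.castRingHom ℚ)).conductorNorm ℤ) ((⟨0, 1, 1, -4, 2⟩ : WeierstrassCurve ℤ).map (Int.castRingHom ℚ)) K p q) ∧
          d.kolyvaginClass hp.out 1 ≠ 0 ∧
          (n₁.primeFactors.card + 1 ≤ ((⟨0, 1, 1, -4, 2⟩ : WeierstrassCurve ℤ).map (Int.castRingHom ℚ)).mordellWeilRank ∨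
            (n₁.primeFactors.card ≤ ((⟨0, 1, 1, -4, 2⟩ : WeierstrassCurve ℤ).map (Int.castRingHom ℚ)).mordellWeilRank ∧
              n₁.primeFactors.card + 1 ≤ (((⟨0, 1, 1, -4, 2⟩ : WeierstrassCurve ℤ).map (Int.castRingHom ℚ)).quadraticTwist (NumberField.discr K : ℚ)).mordellWeilRank)) := by
  haveI := isElliptic_c571b1
  haveI := isGloballyMinimal_c571b1
  haveI iNZ : NeZero (((⟨0, 1, 1, -4, 2⟩ : WeierstrassCurve ℤ).map (Int.castRingHom ℚ)).conductorNorm ℤ) := neZero_conductorNorm_of_isElliptic _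
  haveI iP := Fact.mk (by norm_num : Nat.Prime 5)
  -- the non-zero class at a Kolyvagin PRIME, from the v13 row (←) and the twist datum
  obtain ⟨Dt, β, ι, ℓ, d, hℓ, hkol, hne⟩ := (exactRowZhang_5_neg8_twistSelmer hSW h372 h84 K hK hD).mpr hT
  -- Kodaira–Néron at `5` from `Δ(E₀) = -571`
  have hKN : ∀ v : HeightOneSpectrum (𝓞 ℚ), ((⟨0, 1, 1, -4, 2⟩ : WeierstrassCurve ℤ).map (Int.castRingHom ℚ)).HasMultiplicativeReductionAt v →
      ¬ 5 ∣ ((⟨0, 1, 1, -4, 2⟩ : WeierstrassCurve ℤ).map (Int.castRingHom ℚ)).ordMinimalDiscriminant v :=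
    not_dvd_ordMinimalDiscriminant_of_intModel_table intModel (p := 5) (Δ₀ := -571) (by decide +kernel)
      (B := 8) (by decide +kernel) (by decide +kernel)
  have hH := satisfiesHeegnerHypothesis_conductorNorm_of_intModel intModel K hK.1 hD heegner_neg8
  have hD3 : NumberField.discr K ≠ -3 := by rw [hD]; norm_num
  have hD4 : NumberField.discr K ≠ -4 := by rw [hD]; norm_num
  have hsq : Squarefree ℓ := hℓ.squarefree
  have h5 : (5 : ℕ) ≤ 5 := by norm_num
  have hgood : ((⟨0, 1, 1, -4, 2⟩ : WeierstrassCurve ℤ).map (Int.castRingHom ℚ)).HasGoodReductionAtPrime 5 := goodOrdinary_5.1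
  have hord : ¬ ((5 : ℕ) : ℤ) ∣ ((⟨0, 1, 1, -4, 2⟩ : WeierstrassCurve ℤ).map (Int.castRingHom ℚ)).frobeniusTrace 5 := goodOrdinary_5.2
  have htower : ∀ n : ℕ, ((⟨0, 1, 1, -4, 2⟩ : WeierstrassCurve ℤ).map (Int.castRingHom ℚ)).HasSurjectiveModNGaloisRep (5 ^ n : ℕ) := hasSurjectiveModNGaloisRep_pow_5
  have hkol' : ∀ q ∈ ℓ.primeFactors, Zhang2014.IsKolyvaginPrime (((⟨0, 1, 1, -4, 2⟩ : WeierstrassCurve ℤ).map (Int.castRingHom ℚ)).conductorNorm ℤ) ((⟨0, 1, 1, -4, 2⟩ : WeierstrassCurve ℤ).map (Int.castRingHom ℚ)) K 5 q := by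
    intro q hq
    rw [hℓ.primeFactors, Finset.mem_singleton] at hq
    exact hq ▸ hkol
  have hrank : ℓ.primeFactors.card + 1 ≤ ((⟨0, 1, 1, -4, 2⟩ : WeierstrassCurve ℤ).map (Int.castRingHom ℚ)).mordellWeilRank := by
    rw [hℓ.primeFactors, Finset.card_singleton]
    exact KernelCerts001.C571b1.two_le_rank
  have hne' : d.kolyvaginClass iP.out 1 ≠ 0 := hne
  -- assembled one binder at a time (a single anonymous constructor here times out at `whnf`)
  refine ⟨5, iP, h5, hgood, hord, htower, hKN, ?_⟩
  refine ⟨K, ‹Field K›, ‹NumberField K›, ?_⟩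
  refine ⟨hK, ?_⟩
  refine ⟨hD3, ?_⟩
  refine ⟨hD4, ?_⟩
  refine ⟨iNZ, ?_⟩
  refine ⟨hH, ?_⟩
  refine ⟨Dt, β, ι, ℓ, d, ?_⟩
  refine ⟨hsq, ?_⟩
  refine ⟨hkol', ?_⟩
  refine ⟨hne', ?_⟩
  exact Or.inl hrank

end C571b1

/-! ## `643a1` (`N = 643`) at `p = 5` -/

namespace C643a1

/-- **`Ш(643a1/ℚ)[5] = 0` BY NAME** (Stein–Wuthrich 2013 Thm. 1.1 at the kernel-certified hypotheses of the
lineage: non-CM `not_hasCM`, `2 ≤ rank` `KernelCerts001.C643a1.two_le_rank`, `N ≤ `643 ≤ 30000` (`conductorNorm_eq`)` , `5` good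
ordinary `goodOrdinary_5`, `ρ̄_{E,5}` onto `hasSurjectiveModNGaloisRep_pow_5 1`). CONDITIONAL on that named fact; per curve;
BSD is not proved by it. [cite: SteinWuthrich2013, Thm. 1.1 (p. 1758)] [cite: CremonaAlgorithms1997, Table 1 (643a1)] -/
theorem sha_inf_torsionBy_five_eq_bot (hSW : SteinWuthrich2013_sha_inf_torsionBy_eq_bot_of_two_le_rank) :
    haveI := isElliptic_c643a1;
    haveI := isGloballyMinimal_c643a1;
    haveI := Fact.mk (by norm_num : Nat.Prime 5);
    (((⟨1, 0, 0, -4, 3⟩ : WeierstrassCurve ℤ).map (Int.castRingHom ℚ)).sha ⊓ AddSubgroup.torsionBy ((⟨1, 0, 0, -4, 3⟩ : WeierstrassCurve ℤ).map (Int.castRingHom ℚ)).galH1 ((5 : ℕ) : ℤ) : AddSubgroup _) = ⊥ := by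
  haveI := isElliptic_c643a1
  haveI := isGloballyMinimal_c643a1
  haveI := Fact.mk (by norm_num : Nat.Prime 5)
  have hsur : ((⟨1, 0, 0, -4, 3⟩ : WeierstrassCurve ℤ).map (Int.castRingHom ℚ)).HasSurjectiveModNGaloisRep (5 ^ 1 : ℕ) := hasSurjectiveModNGaloisRep_pow_5 1
  rw [pow_one] at hsur
  exact hSW _ not_hasCM KernelCerts001.C643a1.two_le_rank (by rw [conductorNorm_eq]; norm_num) 5 (by norm_num) (by norm_num)
    goodOrdinary_5.1 goodOrdinary_5.2 hsur

/-- **DEPTH-TABLE ROW `643a1`, `(p, d_K) = (5, -8)`, v13 — «ONE BIT ⟺ ONE TWIST».** For `E = 643a1` and ANY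
imaginary quadratic `K` with `d_K = -8`: «some frame, some Kolyvagin prime `ℓ`, some datum of conductor `ℓ` with
`c_1(ℓ) ≠ 0`» `↔` «`rank_ℤ E^{(-8)}(ℚ) = 1` ∧ `Ш(E^{(-8)}/ℚ)[5] = 0`» — the `5`-part of BSD for the rank-one
Heegner twist ALONE. From the v12 row `exactRowZhang_5_neg8_twoSha` with its conjunct `Ш(E)[5] = 0` discharged by
Stein–Wuthrich Thm. 1.1 (`sha_inf_torsionBy_five_eq_bot`). CONDITIONAL on (γ), W. Zhang's Lemma 8.4 (1) / Thm. 9.1 and SW Thm. 1.1 by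
name; per curve; BSD is not proved by it. [cite: SteinWuthrich2013, Thm. 1.1 (p. 1758)] [cite: WZhang2014, Lemma 8.4 (1) (p. 236), Thm. 9.1 (p. 240)] [cite: GrossLMS1991, Prop. 3.7 (2)]
[cite: SilvermanAEC2009, Thm. X.4.2] -/
theorem exactRowZhang_5_neg8_oneTwist
    (hSW : SteinWuthrich2013_sha_inf_torsionBy_eq_bot_of_two_le_rank)
    (h372 : GrossLMS1991.prop37_2_frobeniusCongruence)
    (h84 : Literature.NumberTheory.EllipticCurves.WZhang2014_lemma84_exists_minimal_kolyvaginClass_one_selmerCard)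
    (K : Type) [Field K] [NumberField K] (hK : IsImaginaryQuadratic K)
    (hD : NumberField.discr K = -8) :
    haveI := isElliptic_c643a1;
    haveI := isGloballyMinimal_c643a1;
    haveI : NeZero (((⟨1, 0, 0, -4, 3⟩ : WeierstrassCurve ℤ).map (Int.castRingHom ℚ)).conductorNorm ℤ) := neZero_conductorNorm_of_isElliptic _;
    haveI := Fact.mk (by norm_num : Nat.Prime 5);
    (∃ (Dt : ModularParametrizationData ((⟨1, 0, 0, -4, 3⟩ : WeierstrassCurve ℤ).map (Int.castRingHom ℚ)) (((⟨1, 0, 0, -4, 3⟩ : WeierstrassCurve ℤ).map (Int.castRingHom ℚ)).conductorNorm ℤ)) (β : ℤ)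
      (ι : K →+* ℂ) (ℓ : ℕ) (d : KolyvaginHeegnerData Dt β ι ℓ),
      ℓ.Prime ∧ Zhang2014.IsKolyvaginPrime (((⟨1, 0, 0, -4, 3⟩ : WeierstrassCurve ℤ).map (Int.castRingHom ℚ)).conductorNorm ℤ) ((⟨1, 0, 0, -4, 3⟩ : WeierstrassCurve ℤ).map (Int.castRingHom ℚ)) K 5 ℓ ∧
        d.kolyvaginClass (p := 5) (by norm_num) 1 ≠ 0) ↔
    ((((⟨1, 0, 0, -4, 3⟩ : WeierstrassCurve ℤ).map (Int.castRingHom ℚ)).quadraticTwist (NumberField.discr K : ℚ)).mordellWeilRank = 1 ∧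
      ((((⟨1, 0, 0, -4, 3⟩ : WeierstrassCurve ℤ).map (Int.castRingHom ℚ)).quadraticTwist (NumberField.discr K : ℚ)).sha ⊓
          AddSubgroup.torsionBy (((⟨1, 0, 0, -4, 3⟩ : WeierstrassCurve ℤ).map (Int.castRingHom ℚ)).quadraticTwist (NumberField.discr K : ℚ)).galH1 ((5 : ℕ) : ℤ) :
          AddSubgroup (((⟨1, 0, 0, -4, 3⟩ : WeierstrassCurve ℤ).map (Int.castRingHom ℚ)).quadraticTwist (NumberField.discr K : ℚ)).galH1) = ⊥) := by
  haveI := isElliptic_c643a1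
  haveI := isGloballyMinimal_c643a1
  haveI : NeZero (((⟨1, 0, 0, -4, 3⟩ : WeierstrassCurve ℤ).map (Int.castRingHom ℚ)).conductorNorm ℤ) := neZero_conductorNorm_of_isElliptic _
  haveI := Fact.mk (by norm_num : Nat.Prime 5)
  exact (exactRowZhang_5_neg8_twoSha h372 h84 K hK hD).trans
    (and_iff_right (sha_inf_torsionBy_five_eq_bot hSW))

/-- **DEPTH-TABLE ROW `643a1`, `(p, d_K) = (5, -8)`, v13 in Selmer currency — «ONE BIT ⟺ ONE TWIST-SELMER
BOUND».** For `E = 643a1` and ANY imaginary quadratic `K` with `d_K = -8`: bit `↔` `#Sel_5(E^{(-8)}/ℚ) ≤ 5`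
(`dim Sel_5(E^{(-8)}) ≤ 1` over `𝔽_5`). From the v11 row `exactRowZhang_5_neg8_rankFree` with `Ш(E)[5] = 0` discharged by
SW Thm. 1.1. CONDITIONAL on (γ), W. Zhang's Lemma 8.4 (1) / Thm. 9.1 and SW Thm. 1.1 by name; per curve; BSD is not proved by it.
[cite: SteinWuthrich2013, Thm. 1.1 (p. 1758)] [cite: WZhang2014, Lemma 8.4 (1) (p. 236), Thm. 9.1 (p. 240)] [cite: GrossLMS1991, Prop. 3.7 (2)] -/
theorem exactRowZhang_5_neg8_twistSelmer
    (hSW : SteinWuthrich2013_sha_inf_torsionBy_eq_bot_of_two_le_rank)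
    (h372 : GrossLMS1991.prop37_2_frobeniusCongruence)
    (h84 : Literature.NumberTheory.EllipticCurves.WZhang2014_lemma84_exists_minimal_kolyvaginClass_one_selmerCard)
    (K : Type) [Field K] [NumberField K] (hK : IsImaginaryQuadratic K)
    (hD : NumberField.discr K = -8) :
    haveI := isElliptic_c643a1;
    haveI := isGloballyMinimal_c643a1;
    haveI : NeZero (((⟨1, 0, 0, -4, 3⟩ : WeierstrassCurve ℤ).map (Int.castRingHom ℚ)).conductorNorm ℤ) := neZero_conductorNorm_of_isElliptic _;
    haveI := Fact.mk (by norm_num : Nat.Prime 5);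
    (∃ (Dt : ModularParametrizationData ((⟨1, 0, 0, -4, 3⟩ : WeierstrassCurve ℤ).map (Int.castRingHom ℚ)) (((⟨1, 0, 0, -4, 3⟩ : WeierstrassCurve ℤ).map (Int.castRingHom ℚ)).conductorNorm ℤ)) (β : ℤ)
      (ι : K →+* ℂ) (ℓ : ℕ) (d : KolyvaginHeegnerData Dt β ι ℓ),
      ℓ.Prime ∧ Zhang2014.IsKolyvaginPrime (((⟨1, 0, 0, -4, 3⟩ : WeierstrassCurve ℤ).map (Int.castRingHom ℚ)).conductorNorm ℤ) ((⟨1, 0, 0, -4, 3⟩ : WeierstrassCurve ℤ).map (Int.castRingHom ℚ)) K 5 ℓ ∧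
        d.kolyvaginClass (p := 5) (by norm_num) 1 ≠ 0) ↔
    Nat.card ((((⟨1, 0, 0, -4, 3⟩ : WeierstrassCurve ℤ).map (Int.castRingHom ℚ)).quadraticTwist (NumberField.discr K : ℚ)).selmerGroup (5 : ℕ)) ≤ 5 := by
  haveI := isElliptic_c643a1
  haveI := isGloballyMinimal_c643a1
  haveI : NeZero (((⟨1, 0, 0, -4, 3⟩ : WeierstrassCurve ℤ).map (Int.castRingHom ℚ)).conductorNorm ℤ) := neZero_conductorNorm_of_isElliptic _
  haveI := Fact.mk (by norm_num : Nat.Prime 5)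
  exact (exactRowZhang_5_neg8_rankFree h372 h84 K hK hD).trans
    (and_iff_right (sha_inf_torsionBy_five_eq_bot hSW))

/-- **THE CRUX `KolyvaginDepthSupplyKN` AT `643a1`, MODULO ONE RANK-ONE DATUM.** Granted the named print facts
(SW Thm. 1.1, (γ), W. Zhang's Lemma 8.4 (1) / Thm. 9.1) and, for ONE imaginary quadratic `K` with `d_K = -8`, the `5`-Selmer bound
`#Sel_5(E^{(d_K)}/ℚ) ≤ 5` of the rank-one Heegner twist (one `5`-descent-free rank-one datum), the CLAUSE of the
crux holds at `W = 643a1` VERBATIM: witnesses `p = 5` (good ordinary, `ρ_{E,5^∞}` onto `hasSurjectiveModNGaloisRep_pow_5`,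
Kodaira–Néron from `Δ(E₀) = -643`), that `K` (Heegner, `heegner_neg8`), `n₁ = ℓ` the Kolyvagin prime of the row's
non-zero class (`exactRowZhang_5_neg8_twistSelmer`, ←), first sign `ν(ℓ) + 1 = 2 ≤ rank_ℤ E(ℚ)` (`KernelCerts001.C643a1.two_le_rank`).
CONDITIONAL on the named facts and the one twist datum; per curve (the open stub (S♭) is untouched); BSD is not proved
by it. [cite: SteinWuthrich2013, Thm. 1.1 (p. 1758)] [cite: WZhang2014, Lemma 8.4 (1) (p. 236), Thm. 9.1 (p. 240)] [cite: GrossLMS1991, Prop. 3.7 (2)] [cite: CremonaAlgorithms1997, Table 1 (643a1)] -/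
theorem cruxBody_of_twistSelmer
    (hSW : SteinWuthrich2013_sha_inf_torsionBy_eq_bot_of_two_le_rank)
    (h372 : GrossLMS1991.prop37_2_frobeniusCongruence)
    (h84 : Literature.NumberTheory.EllipticCurves.WZhang2014_lemma84_exists_minimal_kolyvaginClass_one_selmerCard)
    (K : Type) [Field K] [NumberField K] (hK : IsImaginaryQuadratic K)
    (hD : NumberField.discr K = -8)
    (hT : haveI := isElliptic_c643a1; haveI := isGloballyMinimal_c643a1; 
      Nat.card ((((⟨1, 0, 0, -4, 3⟩ : WeierstrassCurve ℤ).map (Int.castRingHom ℚ)).quadraticTwist (NumberField.discr K : ℚ)).selmerGroup (5 : ℕ)) ≤ 5) :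
    haveI := isElliptic_c643a1;
    haveI := isGloballyMinimal_c643a1;
    ∃ (p : ℕ) (hp : Fact p.Prime), 5 ≤ p ∧ ((⟨1, 0, 0, -4, 3⟩ : WeierstrassCurve ℤ).map (Int.castRingHom ℚ)).HasGoodReductionAtPrime p ∧
      ¬ (p : ℤ) ∣ ((⟨1, 0, 0, -4, 3⟩ : WeierstrassCurve ℤ).map (Int.castRingHom ℚ)).frobeniusTrace p ∧ (∀ n : ℕ, ((⟨1, 0, 0, -4, 3⟩ : WeierstrassCurve ℤ).map (Int.castRingHom ℚ)).HasSurjectiveModNGaloisRep (p ^ n : ℕ)) ∧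
      (∀ v : HeightOneSpectrum (𝓞 ℚ), ((⟨1, 0, 0, -4, 3⟩ : WeierstrassCurve ℤ).map (Int.castRingHom ℚ)).HasMultiplicativeReductionAt v →
        ¬ p ∣ ((⟨1, 0, 0, -4, 3⟩ : WeierstrassCurve ℤ).map (Int.castRingHom ℚ)).ordMinimalDiscriminant v) ∧
      ∃ (K : Type) (_ : Field K) (_ : NumberField K), IsImaginaryQuadratic K ∧
        NumberField.discr K ≠ -3 ∧ NumberField.discr K ≠ -4 ∧
        ∃ (_ : NeZero (((⟨1, 0, 0, -4, 3⟩ : WeierstrassCurve ℤ).map (Int.castRingHom ℚ)).conductorNorm ℤ)), SatisfiesHeegnerHypothesis (((⟨1, 0, 0, -4, 3⟩ : WeierstrassCurve ℤ).map (Int.castRingHom ℚ)).conductorNorm ℤ) K ∧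
        ∃ (Dt : ModularParametrizationData ((⟨1, 0, 0, -4, 3⟩ : WeierstrassCurve ℤ).map (Int.castRingHom ℚ)) (((⟨1, 0, 0, -4, 3⟩ : WeierstrassCurve ℤ).map (Int.castRingHom ℚ)).conductorNorm ℤ)) (β : ℤ) (ι : K →+* ℂ) (n₁ : ℕ)
          (d : KolyvaginHeegnerData Dt β ι n₁), Squarefree n₁ ∧
          (∀ q ∈ n₁.primeFactors, Zhang2014.IsKolyvaginPrime (((⟨1, 0, 0, -4, 3⟩ : WeierstrassCurve ℤ).map (Int.castRingHom ℚ)).conductorNorm ℤ) ((⟨1, 0, 0, -4, 3⟩ : WeierstrassCurve ℤ).map (Int.castRingHom ℚ)) K p q) ∧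
          d.kolyvaginClass hp.out 1 ≠ 0 ∧
          (n₁.primeFactors.card + 1 ≤ ((⟨1, 0, 0, -4, 3⟩ : WeierstrassCurve ℤ).map (Int.castRingHom ℚ)).mordellWeilRank ∨
            (n₁.primeFactors.card ≤ ((⟨1, 0, 0, -4, 3⟩ : WeierstrassCurve ℤ).map (Int.castRingHom ℚ)).mordellWeilRank ∧
              n₁.primeFactors.card + 1 ≤ (((⟨1, 0, 0, -4, 3⟩ : WeierstrassCurve ℤ).map (Int.castRingHom ℚ)).quadraticTwist (NumberField.discr K : ℚ)).mordellWeilRank)) := by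
  haveI := isElliptic_c643a1
  haveI := isGloballyMinimal_c643a1
  haveI iNZ : NeZero (((⟨1, 0, 0, -4, 3⟩ : WeierstrassCurve ℤ).map (Int.castRingHom ℚ)).conductorNorm ℤ) := neZero_conductorNorm_of_isElliptic _
  haveI iP := Fact.mk (by norm_num : Nat.Prime 5)
  -- the non-zero class at a Kolyvagin PRIME, from the v13 row (←) and the twist datum
  obtain ⟨Dt, β, ι, ℓ, d, hℓ, hkol, hne⟩ := (exactRowZhang_5_neg8_twistSelmer hSW h372 h84 K hK hD).mpr hT
  -- Kodaira–Néron at `5` from `Δ(E₀) = -643`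
  have hKN : ∀ v : HeightOneSpectrum (𝓞 ℚ), ((⟨1, 0, 0, -4, 3⟩ : WeierstrassCurve ℤ).map (Int.castRingHom ℚ)).HasMultiplicativeReductionAt v →
      ¬ 5 ∣ ((⟨1, 0, 0, -4, 3⟩ : WeierstrassCurve ℤ).map (Int.castRingHom ℚ)).ordMinimalDiscriminant v :=
    not_dvd_ordMinimalDiscriminant_of_intModel_table intModel (p := 5) (Δ₀ := -643) (by decide +kernel)
      (B := 8) (by decide +kernel) (by decide +kernel)
  have hH := satisfiesHeegnerHypothesis_conductorNorm_of_intModel intModel K hK.1 hD heegner_neg8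
  have hD3 : NumberField.discr K ≠ -3 := by rw [hD]; norm_num
  have hD4 : NumberField.discr K ≠ -4 := by rw [hD]; norm_num
  have hsq : Squarefree ℓ := hℓ.squarefree
  have h5 : (5 : ℕ) ≤ 5 := by norm_num
  have hgood : ((⟨1, 0, 0, -4, 3⟩ : WeierstrassCurve ℤ).map (Int.castRingHom ℚ)).HasGoodReductionAtPrime 5 := goodOrdinary_5.1
  have hord : ¬ ((5 : ℕ) : ℤ) ∣ ((⟨1, 0, 0, -4, 3⟩ : WeierstrassCurve ℤ).map (Int.castRingHom ℚ)).frobeniusTrace 5 := goodOrdinary_5.2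
  have htower : ∀ n : ℕ, ((⟨1, 0, 0, -4, 3⟩ : WeierstrassCurve ℤ).map (Int.castRingHom ℚ)).HasSurjectiveModNGaloisRep (5 ^ n : ℕ) := hasSurjectiveModNGaloisRep_pow_5
  have hkol' : ∀ q ∈ ℓ.primeFactors, Zhang2014.IsKolyvaginPrime (((⟨1, 0, 0, -4, 3⟩ : WeierstrassCurve ℤ).map (Int.castRingHom ℚ)).conductorNorm ℤ) ((⟨1, 0, 0, -4, 3⟩ : WeierstrassCurve ℤ).map (Int.castRingHom ℚ)) K 5 q := by
    intro q hq
    rw [hℓ.primeFactors, Finset.mem_singleton] at hq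
    exact hq ▸ hkol
  have hrank : ℓ.primeFactors.card + 1 ≤ ((⟨1, 0, 0, -4, 3⟩ : WeierstrassCurve ℤ).map (Int.castRingHom ℚ)).mordellWeilRank := by
    rw [hℓ.primeFactors, Finset.card_singleton]
    exact KernelCerts001.C643a1.two_le_rank
  have hne' : d.kolyvaginClass iP.out 1 ≠ 0 := hne
  -- assembled one binder at a time (a single anonymous constructor here times out at `whnf`)
  refine ⟨5, iP, h5, hgood, hord, htower, hKN, ?_⟩
  refine ⟨K, ‹Field K›, ‹NumberField K›, ?_⟩
  refine ⟨hK, ?_⟩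
  refine ⟨hD3, ?_⟩
  refine ⟨hD4, ?_⟩
  refine ⟨iNZ, ?_⟩
  refine ⟨hH, ?_⟩
  refine ⟨Dt, β, ι, ℓ, d, ?_⟩
  refine ⟨hsq, ?_⟩
  refine ⟨hkol', ?_⟩
  refine ⟨hne', ?_⟩
  exact Or.inl hrank

end C643a1

end Summit.BirchSwinnertonDyer.BirchSwinnertonDyer.Theorems.KolyvaginDepthDoor

end
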